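import Mathlib
import Literature.Geometry.Lorentzian.GiorgiKlainermanSzeftel2022.GRWTransformationAlgebra

/-!
# Giorgi–Klainerman–Szeftel, *Wave equations estimates and the nonlinear stability of slowly rotating Kerr black holes* — App. D.5 ledger: the Teukolsky equation for `A̲` in the `A̲₄` form

Sources, read side by side (statements were compared line by line; the loci of both are given
in every docstring):

* `[J]`  E. Giorgi, S. Klainerman, J. Szeftel, *Wave equations estimates and the nonlinear
  stability of slowly rotating Kerr black holes*, Pure Appl. Math. Q. **20** (2024), no. 7
  (doi:10.4310/pamq.241128023033) — Proposition 5.3.1 (file p0198) and Appendix D.5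
  "Proof of Proposition 5.3.1" (file pp. p0864–p0874: Lemma D.5.1, Lemma D.5.2,
  Proposition D.5.3, Lemma D.5.4, Proposition D.5.5, §D.5.2 Steps 1–4).  **Locator
  convention (as in the sibling `ZCoefficientLedger`): `[J]` pages are the FILE pages
  `p0NNN` of the materialised journal PDF (= printed folio + 1), `Lnn` the line of the
  text layer of that file.**
* `[v1]` the same authors, arXiv:2205.14808 (v1), TeX source lines `l.N`:
  Proposition `PROP:TEUK-AB` l.9043–9055, Appendix section `proof-teukolsky-Ab`
  l.35250–35709.

## What is transcribed

App. D.5 derives the Teukolsky equation for `A̲` written for `A̲₄ = ᶜ∇₄A̲ + ½ tr X A̲`,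
`(ᶜ∇₃ + 2 conj(tr X̲) + ½ tr X̲) A̲₄ = ¼(ᶜ𝒟 + H + 4H̲) ⊗̂ (conj(ᶜ𝒟)·A̲ + H̄·A̲) + 3PA̲ + err_TE`
(`[J]` (5.3.1)), in the normalised ingoing principal-geodesic frame of Part II with the gauge
conditions `Ξ = 0`, `Ȟ̲ = 0`.  Its §D.5.1 "Preliminaries" computes the *explicit Kerr parts*
of a handful of linearised quantities — every renormalised quantity is "Kerr value + `Γ`"
(`[J]` Definitions of the linearised quantities `Γ_g, Γ_b`, `[v1]` l.7119–7123,
l.7167–7196): `tr X = 2Δq̄/|q|⁴ + Γ_g`, `tr X̲ = −2/q̄ + Γ_g`, `H = Ȟ + (aq/|q|²)𝔍`,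
`H̲ = −(aq̄/|q|²)𝔍 = −(a/q)𝔍` (gauge `Ȟ̲ = 0`), `Z = (aq/|q|²)𝔍 + Γ_g`, `P = −2m/q³ + P̌`,
`e₃(q) = −1 + rΓ_b`, `e₄(q) = Δ/|q|² + Γ_g`, `∇₃𝔍 = (1/q̄)𝔍 + r⁻¹Γ_b`,
`∇₄𝔍 = −(Δq̄/|q|⁴)𝔍 + r⁻¹Γ_g`, `𝒟q = −a𝔍 + rΓ_g`, `𝒟q̄ = a𝔍 + rΓ_g`, `𝒟Δ = r²Γ_g` — and
checks that the explicit parts CANCEL in: Lemma D.5.1 (`ᶜ𝒟` of `tr X`, `conj tr X`, `tr X̲`,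
`conj tr X̲`), Lemma D.5.2 (`∇₄H̲ + tr X H̲`), Proposition D.5.3 (the `𝔍`-terms `E` of the
transport equations for `Ȟ`, `Ξ̲` and of the Codazzi equation for `conj tr X`), Lemma D.5.4
(`ᶜ𝒟P + 3PH̲`, `ᶜ∇₄P + (3/2) tr X P`).  §D.5.2 is coefficient bookkeeping in the space of
symmetric traceless 2-tensors: Steps 1–3 compute `I, J, K`, Step 4 sums them, observes the
cancellation of all `Ξ̲`-terms and of the `B̲`-coefficient (by Lemma D.5.1), and collects
`err_TE`.

## How it is typed (the scalar shadow; nothing tensorial is derived)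

* §0–§5: an abstract field `K` (think: complex-valued functions of `(r, θ)`), the dictionary
  of the sibling module `GRWTransformationAlgebra` (`qq = q = r + i a cos θ`, `qb = q̄`,
  `nsq = |q|²`, `Del = Δ`, `trXI = 2Δq̄/|q|⁴`, `trXbI = −2/q̄`, `PP = −2m/q³`, `J1, J2`; its
  helpers `D_num`, `nsq_eq_qq_mul_qb`, `qq_ne_zero`, `qb_ne_zero` are used BY NAME, nothing is
  restated), and three derivation models: `E = ∂_θ` for the horizontal operator `𝒟`
  (`E r = E a = E m = E i = 0`, `E cos θ = −sin θ`; then `(𝒟f)₁ = |q|⁻¹∂_θ f`,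
  `(𝒟f)₂ = −i(𝒟f)₁`, and `𝒟q = −a𝔍` reads `E q = −a·(i sin θ)` with `𝔍 ↔ i sin θ`, see
  `calD_components`), `D₄` with `D₄ r = Δ/|q|²` (ingoing `e₄`), `D₃` with `D₃ r = −1`
  (ingoing `e₃`).  A displayed identity "`𝒟f = C 𝔍 + Γ`" is certified as the field identity
  `E f = C·(i sin θ)` on the Kerr parts; "`+ Γ`" terms are dropped (they are definitions, not
  claims).  Signature-0 quantities (`H, H̲, Z, P, q, 𝔍`) have `ᶜ∇ = ∇`; for `tr X`,
  `conj tr X` (signature `+1`) `ᶜ𝒟 = 𝒟 + Z`, for `tr X̲`, `conj tr X̲` (signature `−1`)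
  `ᶜ𝒟 = 𝒟 − Z` (`[v1]` l.4559–4567, footnote l.35433).
* §6: `K`-modules `M₁` (horizontal 1-forms) and `M₂` (symmetric traceless 2-tensors), a
  genuinely bilinear `⊗̂ : M₁ →ₗ M₁ →ₗ M₂` (so every bilinear expansion is kernel-checked), and
  OPAQUE symbols for `ᶜ∇₃`, `ᶜ∇₄`, `ᶜ𝒟⊗̂` applied to the named tensors; the commutation formula,
  the Bianchi and null-structure equations quoted by the text, the Leibniz expansions it
  performs, and every schematic error class (`r⁻²𝔡^{≤1}(Γ_g·Γ_b)`, `(Γ_b·Γ_b)·B`, …, one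
  opaque element per occurrence) enter as HYPOTHESES / free elements.  What the kernel then
  certifies is exactly the displayed coefficient arithmetic of Steps 1–4: the `Ξ̲`-cancellation
  (`9/2 − 6 + 3/2 = 0`, `−3/2 + 3/2 = 0`), the `B̲`-coefficient
  `−(ᶜ𝒟 conj tr X̲ + (conj tr X̲ − tr X̲)H̲)` and its vanishing by (D.5.2), and the `err_TE`
  collection — with the schematic terms carried as an explicit sum, never absorbed.

## Certified (0 sorry; every theorem closes by `simp`/`field_simp`/`ring`/`module`)

All displayed explicit-part cancellations of Lemmas D.5.1, D.5.2, D.5.4 and Proposition D.5.3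
hold on the Kerr values **with `|q|⁴` in `tr X = 2q̄Δ/|q|⁴`** (as printed in Lemma D.5.1,
Lemma D.5.2, (D.5.5) and in `GRWTransformationAlgebra.trXI`); the substitution bookkeeping of
Proposition D.5.5; Steps 1–4 of §D.5.2 as stated, except for the factor recorded next.

## Print data found by the kernel / by collation (offered to the cell's census, not rulings)

1. `[v1]` l.35399 (`= [J]` p0867 L92–96) prints `tr X = 2q̄Δ/|q|² + Γ_g` and l.35403–35404
   (`[J]` p0867 L99–130) the factor `qΔ/|q|²` inside the `E` of Proposition D.5.3; with these
   the displayed bracket does not vanish (`D53a_E_printed_gap`), with `|q|⁴` it does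
   (`D53a_E`).  Same misprint at `[v1]` l.35500, l.35503–35504 (`[J]` p0869 L55–59, L83–94)
   in the proof of Lemma D.5.4 (`D54_nab4_printed_gap` vs `D54_nab4`).  Both texts.
2. `[v1]` l.35500 (`[J]` p0869 L57) writes `P = 2m/q³ + P̌` ten lines after `P = −2m/q³ + P̌`
   (l.35490, `[J]` p0869 L27; Definition l.7123).  The identities are linear in `m`, hence
   blind to the sign (`PP_neg_m`).  Both texts.
3. `[v1]` l.35497 (`[J]` p0869 L49): `r³Γ_g` for `r⁻³Γ_g`.  Both texts.
4. `[v1]` l.35602 (`[J]` p0871 L101–105): `I = ½ᶜ𝒟⊗̂B̲₃ + ½H⊗̂B̲₃ − (…)⊗̂B̲ + err₁ + …`, where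
   halving the preceding display (l.35593–35597) gives `+ ½err₁` (`step1_I`).  Carried to
   Step 4, the literal `err_TE` keeps `+ B̲⊗̂B̲` with coefficient `1`
   (`errTE_derived`), whereas the printed chain l.35698–35707 (`[J]` p0874) cancels
   `−2B̲⊗̂B̲ + 2B̲⊗̂B̲` (`errTE_printed_chain`, internally consistent with the un-halved `err₁`).
   `B̲⊗̂B̲ = r⁻¹(rB̲)·B̲` is of the schematic type of the listed term `tr X Ξ̲⊗̂B̲`
   (`r⁻¹Γ_b·B̲`); whether it needs its own line in the treatment of `err_TE` in App. D.6 is a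
   question for the census, not decided here.  Both texts.
5. Readings at symbol level (not kernel data beyond the stated scalar identities):
   (D.5.3b) prints `−½ conj(tr X) Ȟ` (`[v1]` l.35369, l.35414, l.35430) while solving the
   quoted structure equation l.35409 — whose `E` is printed with `conj(tr X̲)` at l.35416 —
   leaves `−½ conj(tr X̲) Ȟ` (`D53b_symbolic`); on the Kerr values
   `conj tr X + conj tr X̲ = 2q(Δ − q̄²)/|q|⁴` (`trXc_add_trXbc`), so the two are not
   interchangeable modulo `r⁻²Γ_b`.  (D.5.4a) prints `2i Im(tr X̲)Ȟ` (l.35376, l.35467) where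
   the line before (l.35463) has `2i Im(tr X)Ȟ`; here
   `2i Im tr X − 2i Im tr X̲ = −2(q − q̄)(Δ − |q|²)/|q|⁴`, `Δ − |q|² = −2mr + a² sin²θ`
   (`Im_trX_vs_Im_trXb`), an `O(am r⁻³)` multiple of `Ȟ`.  Step 3 quotes the `ᶜ∇₃P` Bianchi
   identity with the last term `−¼ X̲̂·Ā` (`[v1]` l.35655) where the identity itself (l.5266)
   has `−¼ conj(X̂)·A̲`; either is absorbed in the printed `(A, B)·Γ_b` (`sAB` below is opaque).
   `[J]`'s text layer drops under-bars, so these three are read on `[v1]` only (glyph check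
   owed: p0866, p0868, p0873 L21–22).
6. Cosmetic: `Z = aq/|q|² + Γ_g` without `𝔍` at `[v1]` l.35442 = `[J]` p0868 L64.

## Not claimed

No tensorial statement, no commutation formula, no Bianchi or null-structure equation is
derived; the decay classes `Γ_g, Γ_b` and every "`+ r⁻ᵏ𝔡Γ`" are outside the model; the
ledger does not decide items 4–5 beyond the scalar identities named.  Nothing here is a
hypothesis-fact of `[J]`; no `def … : Prop`.  This module is a typed reading aid for the
cell's census of `[J]` ch. 5 / App. D, not progress on any summit.
-/

namespace Literature.Geometry.Lorentzian.GiorgiKlainermanSzeftel2022.TeukolskyAbarLedger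

open Literature.Geometry.Lorentzian.GiorgiKlainermanSzeftel2022.GRWTransformationAlgebra

variable {K : Type*} [Field K]

/-! ## §0 Dictionary of explicit Kerr parts (normalised ingoing PG frame) and helpers -/

/-! ### The explicit Kerr parts used below (normalised ingoing PG frame)

To keep this a theorem-only module the Kerr parts that `GRWTransformationAlgebra` does not
tabulate enter each theorem as a named scalar with its DEFINING HYPOTHESIS:

* `Zk = aq/|q|²` (`= a/q̄`): the coefficient of `𝔍` in `Z` and in `H − Ȟ`
  (`[J]` p0864 L60–66, p0866 L110; `[v1]` l.35284, l.35296, l.7119–7121);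
* `Hbk = −a/q` (`= −aq̄/|q|²`): the coefficient of `𝔍` in `H̲`, gauge `Ȟ̲ = 0`
  (`[J]` p0866 L56, L110; `[v1]` l.35341, l.35386);
* `trXc = 2Δq/|q|⁴ = conj(tr X)`, `trXbc = −2/q = conj(tr X̲)` (`[J]` p0864 L64–70, p0865;
  `[v1]` l.35286, l.35330) — their unconjugated partners are `GRWTransformationAlgebra.trXI`,
  `trXbI`;
* `PPc = −2m/q̄³ = P̄` (`[J]` p0869 L42–50; `[v1]` l.35497); `P` itself is
  `GRWTransformationAlgebra.PP`;
* `j4 = −Δq̄/|q|⁴`, `j3 = 1/q̄`: `∇₄𝔍 = j4·𝔍 + r⁻¹Γ_g`, `∇₃𝔍 = j3·𝔍 + r⁻¹Γ_b` (renormalisation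
  definitions, `[J]` p0866 L62–66, p0867; `[v1]` l.35349, l.35421, l.7178–7180);
* `e₄(q) = Δ/|q|²`, `e₃(q) = −1` are the values of the derivation models `D₄`, `D₃` on `r`. -/

/-- Bookkeeping: from `E f = C·(i sin θ)` (the `E = ∂_θ` shadow of "`𝒟f = C𝔍`") the two
components `(𝒟f)₁ = |q|⁻¹∂_θ f = C𝔍₁`, `(𝒟f)₂ = −i(𝒟f)₁ = C𝔍₂` with `𝔍₁ = i sin θ/|q|`,
`𝔍₂ = sin θ/|q|` (`GRWTransformationAlgebra.J1/J2`, `calD_q_J`). [folklore] -/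
theorem calD_components (i s n C Ef : K) (hi : i ^ 2 = -1)
    (h : Ef = C * (i * s)) :
    1 / n * Ef = C * J1 i s n ∧ -i * (1 / n * Ef) = C * J2 s n := by
  subst h
  unfold J1 J2
  constructor
  · ring
  · linear_combination (-(C * s / n)) * hi

/-- `∂_θ q = −ia sin θ`, i.e. `𝒟q = −a𝔍` in the `E`-model. [cite: GiorgiKlainermanSzeftel2024, p0864 L71; GiorgiKlainermanSzeftel2022, l.35289, l.6019] -/
theorem E_qq (E : Derivation ℤ K K) (i r a c s : K) (hEr : E r = 0) (hEa : E a = 0)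
    (hEc : E c = -s) (hEi : E i = 0) : E (qq i r a c) = -(a * (i * s)) := by
  unfold qq
  simp only [map_add, E.leibniz, hEr, hEa, hEc, hEi, smul_eq_mul, mul_zero, add_zero, zero_add]
  ring

/-- `∂_θ q̄ = ia sin θ`, i.e. `𝒟q̄ = a𝔍` in the `E`-model. [cite: GiorgiKlainermanSzeftel2024, p0864 L71; GiorgiKlainermanSzeftel2022, l.35289] -/
theorem E_qb (E : Derivation ℤ K K) (i r a c s : K) (hEr : E r = 0) (hEa : E a = 0)
    (hEc : E c = -s) (hEi : E i = 0) : E (qb i r a c) = a * (i * s) := by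
  unfold qb
  simp only [map_sub, E.leibniz, hEr, hEa, hEc, hEi, smul_eq_mul, mul_zero, add_zero, zero_sub]
  ring

/-- `∂_θ Δ = 0` (the text's `𝒟(Δ) = r²Γ_g` has no Kerr part). [cite: GiorgiKlainermanSzeftel2024, p0864 L71; GiorgiKlainermanSzeftel2022, l.35289] -/
theorem E_Del (E : Derivation ℤ K K) (r a m : K) (hEr : E r = 0) (hEa : E a = 0) (hEm : E m = 0) :
    E (Del r a m) = 0 := by
  obtain ⟨E2, -⟩ := D_num E
  unfold Del
  simp only [map_add, map_sub, E.leibniz, E.leibniz_pow, hEr, hEa, hEm, E2, smul_eq_mul,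
    mul_zero, add_zero, smul_zero, sub_zero]

/-- For a derivation killing `a, cos θ, i` (the `e₃`, `e₄` models): `D q = D r`. [folklore] -/
theorem D_qq (D : Derivation ℤ K K) (i r a c : K) (hDa : D a = 0) (hDc : D c = 0) (hDi : D i = 0) :
    D (qq i r a c) = D r := by
  unfold qq; simp only [map_add, D.leibniz, hDa, hDc, hDi, smul_eq_mul, mul_zero, add_zero]

/-- For a derivation killing `a, cos θ, i`: `D q̄ = D r`. [folklore] -/
theorem D_qb (D : Derivation ℤ K K) (i r a c : K) (hDa : D a = 0) (hDc : D c = 0) (hDi : D i = 0) :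
    D (qb i r a c) = D r := by
  unfold qb; simp only [map_sub, D.leibniz, hDa, hDc, hDi, smul_eq_mul, mul_zero, add_zero, sub_zero]

/-- `aq/|q|² = a/q̄` and `−a/q = −aq̄/|q|²` (the two printed forms of the `𝔍`-coefficients of
`Z` and `H̲` agree).
[cite: GiorgiKlainermanSzeftel2024, p0866 L56, p0867 L8–16; GiorgiKlainermanSzeftel2022, l.35341, l.35386, l.35403] -/
theorem Zk_Hbk_alt (i r a c : K) (hi : i ^ 2 = -1) (hN : nsq r a c ≠ 0) :
    a * qq i r a c / nsq r a c = a / qb i r a c ∧ -a / qq i r a c = -(a * qb i r a c) / nsq r a c := by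
  have hq := qq_ne_zero i r a c hi hN
  have hqb := qb_ne_zero i r a c hi hN
  rw [nsq_eq_qq_mul_qb i r a c hi]
  constructor
  · field_simp
  · field_simp

/-- `P` at `−m` is `+2m/q³`: the identities below, linear in `m`, cover the sign printed at
`[v1]` l.35500 / `[J]` p0869 L57 (`P = 2m/q³ + P̌`) as well as l.35490 / L27 (`−2m/q³`).
[cite: GiorgiKlainermanSzeftel2024, p0869 L27, L57; GiorgiKlainermanSzeftel2022, l.35490, l.35500, l.7123] -/
theorem PP_neg_m (i r a m c : K) : PP i r a (-m) c = -PP i r a m c ∧ -PP i r a m c = 2 * m / qq i r a c ^ 3 := by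
  unfold PP; constructor <;> ring

/-! ## §1 Lemma D.5.1 (`[v1]` Lemma `Lemma:DDc{trX}`): `ᶜ𝒟` of `tr X`, `conj tr X`, `tr X̲`, `conj tr X̲` -/

/-- "`𝒟(2qΔ/|q|⁴) = 2Δ𝒟(1/(q̄²q)) + r⁻¹Γ_g = −(2Δ/|q|⁴)(𝒟q + (2q/q̄)𝒟q̄) + … = (2aqΔ/|q|⁴)((q̄ − 2q)/|q|²)𝔍 + r⁻¹Γ_g`"
(also the display at `[v1]` l.35456–35457): `E`-model, Kerr parts.
[cite: GiorgiKlainermanSzeftel2024, p0864 L90–142, p0868 L101–140; GiorgiKlainermanSzeftel2022, l.35289–35294, l.35456–35457] -/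
theorem D51_calD_2qDel (E : Derivation ℤ K K) (i r a m c s : K) (hi : i ^ 2 = -1) (hN : nsq r a c ≠ 0)
    (hEr : E r = 0) (hEa : E a = 0) (hEm : E m = 0) (hEc : E c = -s) (hEi : E i = 0) :
    E (2 * qq i r a c * Del r a m / nsq r a c ^ 2)
        = -(2 * Del r a m / nsq r a c ^ 2) * (E (qq i r a c) + 2 * qq i r a c / qb i r a c * E (qb i r a c)) ∧
      E (2 * qq i r a c * Del r a m / nsq r a c ^ 2)
        = 2 * a * qq i r a c * Del r a m / nsq r a c ^ 2 * ((qb i r a c - 2 * qq i r a c) / nsq r a c) * (i * s) := by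
  have hq := qq_ne_zero i r a c hi hN
  have hqb := qb_ne_zero i r a c hi hN
  have Eq := E_qq E i r a c s hEr hEa hEc hEi
  have Eqb := E_qb E i r a c s hEr hEa hEc hEi
  have ED := E_Del E r a m hEr hEa hEm
  obtain ⟨E2, -⟩ := D_num E
  rw [nsq_eq_qq_mul_qb i r a c hi]
  constructor
  · simp only [E.leibniz, E.leibniz_pow, E.leibniz_div, Eq, Eqb, ED, E2, smul_eq_mul,
      nsmul_eq_mul, Nat.cast_ofNat, mul_zero, add_zero, zero_add]
    field_simp
    ring
  · simp only [E.leibniz, E.leibniz_pow, E.leibniz_div, Eq, Eqb, ED, E2, smul_eq_mul,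
      nsmul_eq_mul, Nat.cast_ofNat, mul_zero, add_zero, zero_add]
    field_simp
    ring

/-- (D.5.1a), Kerr parts: "`ᶜ𝒟(conj tr X) = 𝒟 conj(tr X) + conj(tr X) Z = … = 2i Im(tr X)(H − Ȟ) + r⁻¹Γ_g`"
with `2i Im(tr X) = tr X − conj(tr X)` and `H − Ȟ = Z_Kerr = (aq/|q|²)𝔍`; `E`-model
(`𝔍 ↔ i sin θ`).  Second conjunct: the two displayed intermediate lines
"`(2aqΔ/|q|⁴)((q̄ − 2q)/|q|²) + (2Δq/|q|⁴)(aq/|q|²) = (2aqΔ/|q|⁴)((q̄ − q)/|q|²)`" and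
"`2i Im(tr X) = −2Δ(q − q̄)/|q|⁴`".
[cite: GiorgiKlainermanSzeftel2024, (D.5.1) p0864 L37–52, L60–142, p0865 L6–27, p0868 L57–61; GiorgiKlainermanSzeftel2022, l.35270, l.35284–35299, l.35441] -/
theorem D51_conj_trX (E : Derivation ℤ K K) (i r a m c s trXc Zk : K) (hi : i ^ 2 = -1)
    (hN : nsq r a c ≠ 0) (hEr : E r = 0) (hEa : E a = 0) (hEm : E m = 0) (hEc : E c = -s)
    (hEi : E i = 0) (htrXc : trXc = 2 * Del r a m * qq i r a c / nsq r a c ^ 2)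
    (hZk : Zk = a * qq i r a c / nsq r a c) :
    E trXc + trXc * (Zk * (i * s)) = (trXI i r a m c - trXc) * (Zk * (i * s)) ∧
      (2 * a * qq i r a c * Del r a m / nsq r a c ^ 2 * ((qb i r a c - 2 * qq i r a c) / nsq r a c)
          + 2 * Del r a m * qq i r a c / nsq r a c ^ 2 * (a * qq i r a c / nsq r a c)
        = 2 * a * qq i r a c * Del r a m / nsq r a c ^ 2 * ((qb i r a c - qq i r a c) / nsq r a c) ∧
       trXI i r a m c - trXc = -(2 * Del r a m * (qq i r a c - qb i r a c)) / nsq r a c ^ 2) := by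
  have hq := qq_ne_zero i r a c hi hN
  have hqb := qb_ne_zero i r a c hi hN
  have Eq := E_qq E i r a c s hEr hEa hEc hEi
  have Eqb := E_qb E i r a c s hEr hEa hEc hEi
  have ED := E_Del E r a m hEr hEa hEm
  obtain ⟨E2, -⟩ := D_num E
  subst htrXc hZk
  unfold trXI
  rw [nsq_eq_qq_mul_qb i r a c hi]
  refine ⟨?_, ?_, ?_⟩
  · simp only [E.leibniz, E.leibniz_pow, E.leibniz_div, Eq, Eqb, ED, E2, smul_eq_mul,
      nsmul_eq_mul, Nat.cast_ofNat, mul_zero, add_zero]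
    field_simp
    ring
  · field_simp
    ring
  · field_simp
    ring

/-- "`𝒟(2q̄Δ/|q|⁴) = −(2Δ/|q|⁴)(𝒟q̄ + (2q̄/q)𝒟q) + r⁻¹Γ_g = −(2aq̄Δ/|q|⁴)((q − 2q̄)/|q|²)𝔍 + r⁻¹Γ_g`":
`E`-model, Kerr parts.
[cite: GiorgiKlainermanSzeftel2024, p0865 L28–101; GiorgiKlainermanSzeftel2022, l.35306–35311] -/
theorem D51_calD_2qbDel (E : Derivation ℤ K K) (i r a m c s : K) (hi : i ^ 2 = -1) (hN : nsq r a c ≠ 0)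
    (hEr : E r = 0) (hEa : E a = 0) (hEm : E m = 0) (hEc : E c = -s) (hEi : E i = 0) :
    E (2 * qb i r a c * Del r a m / nsq r a c ^ 2)
        = -(2 * Del r a m / nsq r a c ^ 2) * (E (qb i r a c) + 2 * qb i r a c / qq i r a c * E (qq i r a c)) ∧
      E (2 * qb i r a c * Del r a m / nsq r a c ^ 2)
        = -(2 * a * qb i r a c * Del r a m / nsq r a c ^ 2) * ((qq i r a c - 2 * qb i r a c) / nsq r a c) * (i * s) := by
  have hq := qq_ne_zero i r a c hi hN
  have hqb := qb_ne_zero i r a c hi hN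
  have Eq := E_qq E i r a c s hEr hEa hEc hEi
  have Eqb := E_qb E i r a c s hEr hEa hEc hEi
  have ED := E_Del E r a m hEr hEa hEm
  obtain ⟨E2, -⟩ := D_num E
  rw [nsq_eq_qq_mul_qb i r a c hi]
  constructor
  · simp only [E.leibniz, E.leibniz_pow, E.leibniz_div, Eq, Eqb, ED, E2, smul_eq_mul,
      nsmul_eq_mul, Nat.cast_ofNat, mul_zero, add_zero, zero_add]
    field_simp
    ring
  · simp only [E.leibniz, E.leibniz_pow, E.leibniz_div, Eq, Eqb, ED, E2, smul_eq_mul,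
      nsmul_eq_mul, Nat.cast_ofNat, mul_zero, add_zero, zero_add]
    field_simp
    ring

/-- (D.5.1b), Kerr parts: "`ᶜ𝒟(tr X) = 𝒟 tr X + tr X Z = … = (4aq̄²Δ/|q|⁶)𝔍 + r⁻¹Γ_g
= −(4Δq̄/|q|⁴)(−(a/q)𝔍) + r⁻¹Γ_g = −2 tr X H̲ + r⁻¹Γ_g`" (`H̲ = −(a/q)𝔍`); `E`-model.  The
second and third conjuncts are the displayed closed form and its rewriting.
[cite: GiorgiKlainermanSzeftel2024, (D.5.1) p0864 L47–52, p0865 L28–122; GiorgiKlainermanSzeftel2022, l.35271, l.35301–35316] -/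
theorem D51_trX (E : Derivation ℤ K K) (i r a m c s Zk Hbk : K) (hi : i ^ 2 = -1)
    (hN : nsq r a c ≠ 0) (hEr : E r = 0) (hEa : E a = 0) (hEm : E m = 0) (hEc : E c = -s)
    (hEi : E i = 0) (hZk : Zk = a * qq i r a c / nsq r a c) (hHbk : Hbk = -a / qq i r a c) :
    E (trXI i r a m c) + trXI i r a m c * (Zk * (i * s)) = -2 * trXI i r a m c * (Hbk * (i * s)) ∧
      E (trXI i r a m c) + trXI i r a m c * (Zk * (i * s))
        = 4 * a * qb i r a c ^ 2 * Del r a m / nsq r a c ^ 3 * (i * s) ∧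
      4 * a * qb i r a c ^ 2 * Del r a m / nsq r a c ^ 3
        = -(4 * Del r a m * qb i r a c / nsq r a c ^ 2) * Hbk := by
  have hq := qq_ne_zero i r a c hi hN
  have hqb := qb_ne_zero i r a c hi hN
  have Eq := E_qq E i r a c s hEr hEa hEc hEi
  have Eqb := E_qb E i r a c s hEr hEa hEc hEi
  have ED := E_Del E r a m hEr hEa hEm
  obtain ⟨E2, -⟩ := D_num E
  subst hZk hHbk
  unfold trXI
  rw [nsq_eq_qq_mul_qb i r a c hi]
  refine ⟨?_, ?_, ?_⟩
  · simp only [E.leibniz, E.leibniz_pow, E.leibniz_div, Eq, Eqb, ED, E2, smul_eq_mul,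
      nsmul_eq_mul, Nat.cast_ofNat, mul_zero, add_zero]
    field_simp
    ring
  · simp only [E.leibniz, E.leibniz_pow, E.leibniz_div, Eq, Eqb, ED, E2, smul_eq_mul,
      nsmul_eq_mul, Nat.cast_ofNat, mul_zero, add_zero]
    field_simp
    ring
  · field_simp

/-- (D.5.2b), Kerr parts: "`ᶜ𝒟(tr X̲) = 𝒟 tr X̲ − tr X̲ Z = −𝒟(2/q̄) + (2/q̄)(aq/|q|²)𝔍 + …
= (2a/q̄²)𝔍 + (2a/q̄²)𝔍 + r⁻¹Γ_g = −2 tr X̲ (H − Ȟ) + r⁻¹Γ_g`"; `E`-model (the two summands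
separately in the second conjunct).
[cite: GiorgiKlainermanSzeftel2024, (D.5.2) p0864 L53–57, p0865 L123–161; GiorgiKlainermanSzeftel2022, l.35278, l.35320–35326] -/
theorem D51_trXb (E : Derivation ℤ K K) (i r a c s Zk : K) (hi : i ^ 2 = -1) (hN : nsq r a c ≠ 0)
    (hEr : E r = 0) (hEa : E a = 0) (hEc : E c = -s) (hEi : E i = 0)
    (hZk : Zk = a * qq i r a c / nsq r a c) :
    E (trXbI i r a c) - trXbI i r a c * (Zk * (i * s)) = -2 * trXbI i r a c * (Zk * (i * s)) ∧
      (E (trXbI i r a c) = 2 * a / qb i r a c ^ 2 * (i * s) ∧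
        -(trXbI i r a c * Zk) = 2 * a / qb i r a c ^ 2) := by
  have hq := qq_ne_zero i r a c hi hN
  have hqb := qb_ne_zero i r a c hi hN
  have Eqb := E_qb E i r a c s hEr hEa hEc hEi
  obtain ⟨E2, -⟩ := D_num E
  subst hZk
  unfold trXbI
  rw [nsq_eq_qq_mul_qb i r a c hi]
  refine ⟨?_, ?_, ?_⟩
  · simp only [map_neg, E.leibniz_div, Eqb, E2, smul_eq_mul]
    field_simp
    ring
  · simp only [map_neg, E.leibniz_div, Eqb, E2, smul_eq_mul]
    field_simp
    ring
  · field_simp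

/-- (D.5.2a), Kerr parts: "`ᶜ𝒟(conj tr X̲) = 𝒟 conj(tr X̲) − conj(tr X̲) Z = −𝒟(2/q) + (2/q)(aq/|q|²)𝔍 + …
= −(2a/q²)𝔍 + (2a/|q|²)𝔍 + r⁻¹Γ_g = (2/q̄ − 2/q)(a/q)𝔍 + r⁻¹Γ_g = 2i Im(tr X̲) H̲ + r⁻¹Γ_g`", with
`2i Im(tr X̲) = tr X̲ − conj(tr X̲) = −2/q̄ + 2/q` and `H̲ = −(a/q)𝔍` (so the last step uses
`(2/q̄ − 2/q)(a/q) = (−2/q̄ + 2/q)(−a/q)`); `E`-model.  This is the identity invoked in Step 4.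
[cite: GiorgiKlainermanSzeftel2024, (D.5.2) p0864 L53–57, p0866 L5–55, p0873 L103–107; GiorgiKlainermanSzeftel2022, l.35277, l.35327–35333, l.35677–35680] -/
theorem D51_conj_trXb (E : Derivation ℤ K K) (i r a c s trXbc Zk Hbk : K) (hi : i ^ 2 = -1)
    (hN : nsq r a c ≠ 0) (hEr : E r = 0) (hEa : E a = 0) (hEc : E c = -s) (hEi : E i = 0)
    (htrXbc : trXbc = -2 / qq i r a c) (hZk : Zk = a * qq i r a c / nsq r a c) (hHbk : Hbk = -a / qq i r a c) :
    E trXbc - trXbc * (Zk * (i * s)) = (trXbI i r a c - trXbc) * (Hbk * (i * s)) ∧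
      (E trXbc = -(2 * a / qq i r a c ^ 2) * (i * s) ∧
        -(2 * a / qq i r a c ^ 2) + 2 * a / nsq r a c
          = (2 / qb i r a c - 2 / qq i r a c) * (a / qq i r a c)) := by
  have hq := qq_ne_zero i r a c hi hN
  have hqb := qb_ne_zero i r a c hi hN
  have Eq := E_qq E i r a c s hEr hEa hEc hEi
  obtain ⟨E2, -⟩ := D_num E
  subst htrXbc hZk hHbk
  unfold trXbI
  rw [nsq_eq_qq_mul_qb i r a c hi]
  refine ⟨?_, ?_, ?_⟩
  · simp only [map_neg, E.leibniz_div, Eq, E2, smul_eq_mul, mul_zero, zero_sub, neg_div]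
    field_simp
    ring
  · simp only [map_neg, E.leibniz_div, Eq, E2, smul_eq_mul, mul_zero, zero_sub, neg_div]
    field_simp
  · field_simp
    ring

/-! ## §2 Lemma D.5.2 (`[v1]` Lemma `Lemma:nabc_4Hb`): `∇₄H̲ + tr X H̲ = r⁻²Γ_g` -/

/-- Lemma D.5.2, Kerr parts, `D₄`-model (`D₄ r = Δ/|q|² = e₄(q)`):
"`∇₄H̲ = ∇₄(−(a/q)𝔍) = (a∇₄q/q²)𝔍 − (a/q)(−(Δq̄/|q|⁴)𝔍 + …)
= (aΔ/(q²|q|²) + aq̄Δ/(q|q|⁴))𝔍 = (aΔ/|q|²)(1/q² + q̄/(q|q|²))𝔍 = 2(aΔ/|q|²)(q̄²/|q|⁴)𝔍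
= −(2Δq̄/|q|⁴)H̲ = −tr X H̲`" — the coefficient of `𝔍` in `∇₄H̲` is `D₄(Hbk) + Hbk·j4`.
The conjuncts are the final identity and the three displayed rewritings.  (The text's
"`ᶜ∇₄q = ½ tr X q + rΓ_g`" is `GRWTransformationAlgebra.nabla4_q_in`.)
[cite: GiorgiKlainermanSzeftel2024, Lemma D.5.2 p0866 L56–122; GiorgiKlainermanSzeftel2022, l.35339–35359] -/
theorem D52_nab4_Hb (D : Derivation ℤ K K) (i r a m c Hbk j4 : K) (hi : i ^ 2 = -1)
    (hN : nsq r a c ≠ 0) (hDr : D r = Del r a m / nsq r a c) (hDa : D a = 0) (hDc : D c = 0)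
    (hDi : D i = 0) (hHbk : Hbk = -a / qq i r a c) (hj4 : j4 = -(Del r a m * qb i r a c) / nsq r a c ^ 2) :
    D Hbk + Hbk * j4 = -trXI i r a m c * Hbk ∧
      D Hbk + Hbk * j4
        = a * Del r a m / (qq i r a c ^ 2 * nsq r a c) + a * qb i r a c * Del r a m / (qq i r a c * nsq r a c ^ 2) ∧
      a * Del r a m / (qq i r a c ^ 2 * nsq r a c) + a * qb i r a c * Del r a m / (qq i r a c * nsq r a c ^ 2)
        = 2 * (a * Del r a m / nsq r a c) * (qb i r a c ^ 2 / nsq r a c ^ 2) ∧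
      2 * (a * Del r a m / nsq r a c) * (qb i r a c ^ 2 / nsq r a c ^ 2)
        = -(2 * Del r a m * qb i r a c / nsq r a c ^ 2) * Hbk := by
  have hq := qq_ne_zero i r a c hi hN
  have hqb := qb_ne_zero i r a c hi hN
  have Dq : D (qq i r a c) = Del r a m / nsq r a c := by rw [D_qq D i r a c hDa hDc hDi, hDr]
  subst hHbk hj4
  unfold trXI
  rw [nsq_eq_qq_mul_qb i r a c hi] at Dq ⊢
  refine ⟨?_, ?_, ?_, ?_⟩
  · simp only [D.leibniz_div, Dq, hDa, smul_eq_mul, mul_zero, zero_sub, neg_div, map_neg]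
    field_simp
    ring
  · simp only [D.leibniz_div, Dq, hDa, smul_eq_mul, mul_zero, zero_sub, neg_div, map_neg]
    field_simp
  · field_simp
    ring
  · field_simp

/-! ## §3 Proposition D.5.3 (`[v1]` `prop:preliminaries-qfb-null-structure`) -/

/-- (D.5.3a): the `𝔍`-coefficient of
`E = ᶜ∇₄((aq/|q|²)𝔍) + ½ conj(tr X)((aq/|q|²)𝔍 + (aq̄/|q|²)𝔍)` vanishes on the Kerr parts,
`D₄`-model, **with `conj(tr X) = 2Δq/|q|⁴`**: first conjunct.  Second conjunct: the displayed
bracket "`−(a/q̄²)(Δ/|q|²) − aΔ/|q|⁴ + (qΔ/|q|⁴)(aq/|q|² + aq̄/|q|²)`" read with `|q|⁴`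
vanishes.  (`H` has signature `0`, so `ᶜ∇₄ = ∇₄` on the scalar factor.)
[cite: GiorgiKlainermanSzeftel2024, (D.5.3) p0866 L124–147, p0867 L5–131; GiorgiKlainermanSzeftel2022, l.35368, l.35382–35405] -/
theorem D53a_E [CharZero K] (D : Derivation ℤ K K) (i r a m c Zk j4 trXc : K) (hi : i ^ 2 = -1)
    (hN : nsq r a c ≠ 0) (hDr : D r = Del r a m / nsq r a c) (hDa : D a = 0) (hDc : D c = 0)
    (hDi : D i = 0) (hZk : Zk = a * qq i r a c / nsq r a c) (hj4 : j4 = -(Del r a m * qb i r a c) / nsq r a c ^ 2)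
    (htrXc : trXc = 2 * Del r a m * qq i r a c / nsq r a c ^ 2) :
    D Zk + Zk * j4 + 1 / 2 * trXc * (Zk + a * qb i r a c / nsq r a c) = 0 ∧
      -(a / qb i r a c ^ 2) * (Del r a m / nsq r a c) - a * Del r a m / nsq r a c ^ 2
        + qq i r a c * Del r a m / nsq r a c ^ 2 * (a * qq i r a c / nsq r a c + a * qb i r a c / nsq r a c) = 0 := by
  have hq := qq_ne_zero i r a c hi hN
  have hqb := qb_ne_zero i r a c hi hN
  have Dq : D (qq i r a c) = Del r a m / nsq r a c := by rw [D_qq D i r a c hDa hDc hDi, hDr]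
  have Dqb : D (qb i r a c) = Del r a m / nsq r a c := by rw [D_qb D i r a c hDa hDc hDi, hDr]
  subst hZk hj4 htrXc
  rw [nsq_eq_qq_mul_qb i r a c hi] at Dq Dqb ⊢
  constructor
  · simp only [D.leibniz_div, D.leibniz, Dq, Dqb, hDa, smul_eq_mul, mul_zero, add_zero]
    field_simp
    ring
  · field_simp
    ring

/-- PRINT DATUM (both texts): read literally with `tr X = 2q̄Δ/|q|²` (`[v1]` l.35399,
`[J]` p0867 L92–96) and the factor `qΔ/|q|²` (l.35403–35404, p0867 L99–130), the displayed
bracket of the `E` in (D.5.3a) equals `aqΔ(q + q̄)(|q|² − 1)/|q|⁶`, not `0`; compare `D53a_E`.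
[cite: GiorgiKlainermanSzeftel2024, p0867 L92–130; GiorgiKlainermanSzeftel2022, l.35396–35404] -/
theorem D53a_E_printed_gap (i r a m c : K) (hi : i ^ 2 = -1) (hN : nsq r a c ≠ 0) :
    -(a / qb i r a c ^ 2) * (Del r a m / nsq r a c) - a * Del r a m / nsq r a c ^ 2
        + qq i r a c * Del r a m / nsq r a c * (a * qq i r a c / nsq r a c + a * qb i r a c / nsq r a c)
      = a * qq i r a c * Del r a m * (qq i r a c + qb i r a c) * (nsq r a c - 1) / nsq r a c ^ 3 := by
  have hq := qq_ne_zero i r a c hi hN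
  have hqb := qb_ne_zero i r a c hi hN
  rw [nsq_eq_qq_mul_qb i r a c hi]
  field_simp
  ring

/-- (D.5.3b): the `𝔍`-coefficient of
`E = ᶜ∇₃((a/q)𝔍) + ½ conj(tr X̲)((a/q)𝔍 + (aq/|q|²)𝔍)` vanishes on the Kerr parts, `D₃`-model
(`D₃ r = −1 = e₃(q)`, `∇₃𝔍 = (1/q̄)𝔍`): "`E = −(a/q²)(−1)𝔍 + (a/q)(1/q̄)𝔍 + ½(−2/q)(a/q + aq/|q|²)𝔍 + … = r⁻²Γ_b`".
[cite: GiorgiKlainermanSzeftel2024, p0867 L133–171, p0868 L5–41; GiorgiKlainermanSzeftel2022, l.35406–35432] -/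
theorem D53b_E [CharZero K] (D : Derivation ℤ K K) (i r a c j3 trXbc Zk : K) (hi : i ^ 2 = -1)
    (hN : nsq r a c ≠ 0) (hDr : D r = -1) (hDa : D a = 0) (hDc : D c = 0) (hDi : D i = 0)
    (hj3 : j3 = 1 / qb i r a c) (htrXbc : trXbc = -2 / qq i r a c) (hZk : Zk = a * qq i r a c / nsq r a c) :
    D (a / qq i r a c) + a / qq i r a c * j3 + 1 / 2 * trXbc * (a / qq i r a c + Zk) = 0 ∧
      D (a / qq i r a c) = -(a / qq i r a c ^ 2) * (-1) := by
  have hq := qq_ne_zero i r a c hi hN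
  have hqb := qb_ne_zero i r a c hi hN
  have Dq : D (qq i r a c) = -1 := by rw [D_qq D i r a c hDa hDc hDi, hDr]
  subst hj3 htrXbc hZk
  rw [nsq_eq_qq_mul_qb i r a c hi]
  constructor
  · simp only [D.leibniz_div, Dq, hDa, smul_eq_mul, mul_zero, zero_sub]
    field_simp
    ring
  · simp only [D.leibniz_div, Dq, hDa, smul_eq_mul, mul_zero, zero_sub]
    field_simp

section Symbolic

variable {M₁ : Type*} [AddCommGroup M₁] [Module K M₁]

/-- (D.5.3b) at symbol level.  Solving the quoted structure equation
`ᶜ∇₃H̲ − ᶜ∇₄Ξ̲ = −½ conj(tr X̲)(H̲ − H) − ½ X̲̂·(H̲̄ − H̄) + B̲` (`XhC` names the `X̲̂`-term) with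
`H̲ = hb` (explicit, gauge `Ȟ̲ = 0`) and `H = Ȟ + hh` (`hh = (aq/|q|²)𝔍`) gives
`ᶜ∇₄Ξ̲ = −E − ½ conj(tr X̲) Ȟ − B̲ + ½ XhC` with `E = −ᶜ∇₃H̲ − ½ conj(tr X̲)(hb − hh)`
(`= ᶜ∇₃((a/q)𝔍) + ½ conj(tr X̲)((a/q)𝔍 + (aq/|q|²)𝔍)`, the printed `E`, l.35415–35416): the
scalar multiplying `Ȟ` is the `conj(tr X̲)` of the quoted equation.  READING (not kernel data
beyond this identity): (D.5.3b) is printed with `−½ conj(tr X) Ȟ` at `[v1]` l.35369, l.35414,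
l.35430 (`[J]` p0866 L134–147, p0868 L36–41; under-bars are not recoverable from the `[J]` text
layer); see `trXc_add_trXbc` for the size of the difference on the Kerr values.
[cite: GiorgiKlainermanSzeftel2024, p0867 L133–150, p0868 L36–41; GiorgiKlainermanSzeftel2022, l.35406–35431, l.5246] -/
theorem D53b_symbolic [CharZero K] (xb : K) (n3Hb n4Xib Hb H Hc hb hh Bb XhC : M₁)
    (hstruct : n3Hb - n4Xib = -((1 / 2 : K) • (xb • (Hb - H))) - (1 / 2 : K) • XhC + Bb)
    (hHb : Hb = hb) (hH : H = Hc + hh) :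
    n4Xib = -(-n3Hb - (1 / 2 : K) • (xb • (hb - hh))) - (1 / 2 : K) • (xb • Hc) - Bb + (1 / 2 : K) • XhC := by
  subst hHb hH
  rw [show n4Xib = n3Hb - (-((1 / 2 : K) • (xb • (Hb - (Hc + hh)))) - (1 / 2 : K) • XhC + Bb) by
    rw [← hstruct]; abel]
  module

end Symbolic

/-- On the Kerr values, `conj(tr X) + conj(tr X̲) = 2q(Δ − q̄²)/|q|⁴` and
`conj(tr X) − conj(tr X̲) = 2q(Δ + q̄²)/|q|⁴`, with `Δ − q̄² = −2mr + a² + a²cos²θ + 2iar cos θ`: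
the data behind reading 5 of the header (`conj tr X̲` vs `conj tr X` in (D.5.3b)).
[cite: GiorgiKlainermanSzeftel2024, p0866 L134–147; GiorgiKlainermanSzeftel2022, l.35369, l.35409–35416] -/
theorem trXc_add_trXbc (i r a m c trXc trXbc : K) (hi : i ^ 2 = -1) (hN : nsq r a c ≠ 0)
    (htrXc : trXc = 2 * Del r a m * qq i r a c / nsq r a c ^ 2) (htrXbc : trXbc = -2 / qq i r a c) :
    trXc + trXbc = 2 * qq i r a c * (Del r a m - qb i r a c ^ 2) / nsq r a c ^ 2 ∧
      trXc - trXbc = 2 * qq i r a c * (Del r a m + qb i r a c ^ 2) / nsq r a c ^ 2 ∧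
      Del r a m - qb i r a c ^ 2 = -(2 * m * r) + a ^ 2 + a ^ 2 * c ^ 2 + 2 * i * a * r * c := by
  have hq := qq_ne_zero i r a c hi hN
  have hqb := qb_ne_zero i r a c hi hN
  subst htrXc htrXbc
  refine ⟨?_, ?_, ?_⟩
  · rw [nsq_eq_qq_mul_qb i r a c hi]
    field_simp
    ring
  · rw [nsq_eq_qq_mul_qb i r a c hi]
    field_simp
    ring
  · unfold Del qb
    linear_combination (-(a ^ 2 * c ^ 2)) * hi

/-- The Codazzi part of Proposition D.5.3 (`[J]` (D.5.5) → (D.5.4a)), Kerr parts, `E`-model: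
"`𝒟 conj(tr X) + conj(tr X) Z − 2i Im(tr X) H = 𝒟 conj(tř X) − 2i Im(tr X) Ȟ + 𝒟(2qΔ/|q|⁴)
+ (2aqΔ/|q|⁴)(q/|q|² + (q − q̄)/|q|²)𝔍 + r⁻¹Γ_g`" and, by `D51_calD_2qDel`, the explicit
terms cancel ("Hence `… = ᶜ𝒟(conj tř X) − 2i Im(tr X)Ȟ + r⁻¹Γ_g`").  First conjunct: the
displayed regrouping `(2qΔ/|q|⁴)(aq/|q|²) + (2Δ(q − q̄)/|q|⁴)(aq/|q|²) = (2aqΔ/|q|⁴)(q/|q|² + (q − q̄)/|q|²)`;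
second: the total cancellation `E(2qΔ/|q|⁴) + (2aqΔ/|q|⁴)((q + (q − q̄))/|q|²)·(i sin θ) = 0`.
[cite: GiorgiKlainermanSzeftel2024, (D.5.4)–(D.5.5) p0866 L148–165, p0868 L43–160; GiorgiKlainermanSzeftel2022, l.35374–35377, l.35433–35468] -/
theorem D53_codazzi_explicit (E : Derivation ℤ K K) (i r a m c s : K) (hi : i ^ 2 = -1)
    (hN : nsq r a c ≠ 0) (hEr : E r = 0) (hEa : E a = 0) (hEm : E m = 0) (hEc : E c = -s)
    (hEi : E i = 0) :
    2 * qq i r a c * Del r a m / nsq r a c ^ 2 * (a * qq i r a c / nsq r a c)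
          + 2 * Del r a m * (qq i r a c - qb i r a c) / nsq r a c ^ 2 * (a * qq i r a c / nsq r a c)
        = 2 * a * qq i r a c * Del r a m / nsq r a c ^ 2
            * (qq i r a c / nsq r a c + (qq i r a c - qb i r a c) / nsq r a c) ∧
      E (2 * qq i r a c * Del r a m / nsq r a c ^ 2)
          + 2 * a * qq i r a c * Del r a m / nsq r a c ^ 2
              * ((qq i r a c + (qq i r a c - qb i r a c)) / nsq r a c) * (i * s) = 0 := by
  have hq := qq_ne_zero i r a c hi hN
  have hqb := qb_ne_zero i r a c hi hN
  obtain ⟨-, h2⟩ := D51_calD_2qDel E i r a m c s hi hN hEr hEa hEm hEc hEi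
  constructor
  · ring
  · rw [h2, nsq_eq_qq_mul_qb i r a c hi]
    field_simp
    ring

/-- `2i Im(tr X) = tr X − conj(tr X)` versus `2i Im(tr X̲) = tr X̲ − conj(tr X̲)` on the Kerr
values: their difference is `−2(q − q̄)(Δ − |q|²)/|q|⁴`, and `Δ − |q|² = −2mr + a²(1 − cos²θ)`.
Data behind reading 5 of the header: the last line of the Codazzi computation has
`2i Im(tr X) Ȟ` (`[v1]` l.35463) and (D.5.4a) prints `2i Im(tr X̲) Ȟ` (l.35376, l.35467).
[cite: GiorgiKlainermanSzeftel2024, (D.5.4) p0866 L159–165, p0868 L142–160; GiorgiKlainermanSzeftel2022, l.35376, l.35462–35467] -/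
theorem Im_trX_vs_Im_trXb (i r a m c trXc trXbc : K) (hi : i ^ 2 = -1) (hN : nsq r a c ≠ 0)
    (htrXc : trXc = 2 * Del r a m * qq i r a c / nsq r a c ^ 2) (htrXbc : trXbc = -2 / qq i r a c) :
    (trXI i r a m c - trXc) - (trXbI i r a c - trXbc)
        = -(2 * (qq i r a c - qb i r a c) * (Del r a m - nsq r a c)) / nsq r a c ^ 2 ∧
      Del r a m - nsq r a c = -(2 * m * r) + a ^ 2 * (1 - c ^ 2) := by
  have hq := qq_ne_zero i r a c hi hN
  have hqb := qb_ne_zero i r a c hi hN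
  subst htrXc htrXbc
  constructor
  · unfold trXI trXbI
    rw [nsq_eq_qq_mul_qb i r a c hi]
    field_simp
    ring
  · unfold Del nsq
    ring

/-! ## §4 Lemma D.5.4 (`[v1]` Lemma `remark:DDcP-DDcov{P}`, (eq:error-DDP)) -/

/-- (D.5.6a), Kerr parts, `E`-model: "`ᶜ𝒟P = 𝒟(−2m/q³ + P̌) = (6m/q⁴)𝒟(q) + 𝒟P̌
= (6m/q³)H̲ + 𝒟P̌ + r⁻³Γ_g`" and `(6m/q³)H̲ = −3PH̲` (`P = −2m/q³`, `H̲ = −(a/q)𝔍`,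
`𝒟q = −a𝔍`); three conjuncts: the chain rule step, the rewriting, the final form.
[cite: GiorgiKlainermanSzeftel2024, Lemma D.5.4 (D.5.6) p0869 L5–41; GiorgiKlainermanSzeftel2022, l.35475–35493] -/
theorem D54_calD_P (E : Derivation ℤ K K) (i r a m c s Hbk : K) (hi : i ^ 2 = -1) (hN : nsq r a c ≠ 0)
    (hEr : E r = 0) (hEa : E a = 0) (hEm : E m = 0) (hEc : E c = -s) (hEi : E i = 0)
    (hHbk : Hbk = -a / qq i r a c) :
    E (PP i r a m c) = 6 * m / qq i r a c ^ 4 * E (qq i r a c) ∧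
      6 * m / qq i r a c ^ 4 * (-(a * (i * s))) = 6 * m / qq i r a c ^ 3 * (Hbk * (i * s)) ∧
      E (PP i r a m c) = -3 * PP i r a m c * (Hbk * (i * s)) := by
  have hq := qq_ne_zero i r a c hi hN
  have Eq := E_qq E i r a c s hEr hEa hEc hEi
  obtain ⟨E2, -⟩ := D_num E
  have hP : E (PP i r a m c) = 6 * m / qq i r a c ^ 4 * E (qq i r a c) := by
    unfold PP
    simp only [map_neg, E.leibniz_div, E.leibniz, E.leibniz_pow, hEm, E2, smul_eq_mul, nsmul_eq_mul,
      Nat.cast_ofNat, mul_zero, add_zero]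
    field_simp
    ring
  subst hHbk
  refine ⟨hP, ?_, ?_⟩
  · field_simp
  · rw [hP, Eq]
    unfold PP
    field_simp
    ring

/-- (D.5.6b), Kerr parts, `E`-model: "`ᶜ𝒟P̄ = (6m/q̄⁴)𝒟(q̄) + 𝒟P̌̄ = (6m/q̄⁴)(a𝔍 + rΓ_g) + …
= −3P̄(H − Ȟ) + 𝒟P̌̄ + r⁻³Γ_g`" (`H − Ȟ = (aq/|q|²)𝔍`; the text prints `r³Γ_g` here,
`[v1]` l.35497 = `[J]` p0869 L49 — print datum 3 of the header).
[cite: GiorgiKlainermanSzeftel2024, (D.5.6) p0869 L10–15, L42–50; GiorgiKlainermanSzeftel2022, l.35481, l.35495–35497] -/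
theorem D54_calD_Pbar (E : Derivation ℤ K K) (i r a m c s PPc Zk : K) (hi : i ^ 2 = -1)
    (hN : nsq r a c ≠ 0) (hEr : E r = 0) (hEa : E a = 0) (hEm : E m = 0) (hEc : E c = -s)
    (hEi : E i = 0) (hPPc : PPc = -(2 * m) / qb i r a c ^ 3) (hZk : Zk = a * qq i r a c / nsq r a c) :
    E PPc = 6 * m / qb i r a c ^ 4 * (a * (i * s)) ∧ E PPc = -3 * PPc * (Zk * (i * s)) := by
  have hq := qq_ne_zero i r a c hi hN
  have hqb := qb_ne_zero i r a c hi hN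
  have Eqb := E_qb E i r a c s hEr hEa hEc hEi
  obtain ⟨E2, -⟩ := D_num E
  subst hPPc hZk
  have hP : E (-(2 * m) / qb i r a c ^ 3) = 6 * m / qb i r a c ^ 4 * (a * (i * s)) := by
    simp only [map_neg, E.leibniz_div, E.leibniz, E.leibniz_pow, hEm, E2, Eqb, smul_eq_mul,
      nsmul_eq_mul, Nat.cast_ofNat, mul_zero, add_zero]
    field_simp
    ring
  refine ⟨hP, ?_⟩
  rw [hP]
  rw [nsq_eq_qq_mul_qb i r a c hi]
  field_simp
  ring

/-- Lemma D.5.4, second part, Kerr parts, `D₄`-model: the explicit part of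
`ᶜ∇₄P + (3/2) tr X P` vanishes, "`−(6m/q⁴)ᶜ∇₄q + (3/2)(2q̄Δ/|q|⁴)(2m/q³) = −(6m/q⁴)(Δ/|q|²)
+ (6m/q³)(q̄Δ/|q|⁴) = 0`" — stated for `PP = −2m/q³` (the displayed computation uses
`+2m/q³`; by `PP_neg_m` it is the same identity at `−m`) and **with `|q|⁴`**.  Conjuncts:
the cancellation on `PP`; the displayed two-term line with `|q|⁴`.
[cite: GiorgiKlainermanSzeftel2024, p0869 L17–24, L55–99; GiorgiKlainermanSzeftel2022, l.35484–35507] -/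
theorem D54_nab4 [CharZero K] (D : Derivation ℤ K K) (i r a m c : K) (hi : i ^ 2 = -1) (hN : nsq r a c ≠ 0)
    (hDr : D r = Del r a m / nsq r a c) (hDa : D a = 0) (hDm : D m = 0) (hDc : D c = 0) (hDi : D i = 0) :
    D (PP i r a m c) + 3 / 2 * trXI i r a m c * PP i r a m c = 0 ∧
      -(6 * m / qq i r a c ^ 4) * (Del r a m / nsq r a c)
        + 3 / 2 * (2 * qb i r a c * Del r a m / nsq r a c ^ 2) * (2 * m / qq i r a c ^ 3) = 0 := by
  have hq := qq_ne_zero i r a c hi hN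
  have hqb := qb_ne_zero i r a c hi hN
  have Dq : D (qq i r a c) = Del r a m / nsq r a c := by rw [D_qq D i r a c hDa hDc hDi, hDr]
  obtain ⟨D2, -⟩ := D_num D
  unfold PP trXI
  rw [nsq_eq_qq_mul_qb i r a c hi] at Dq ⊢
  constructor
  · simp only [map_neg, D.leibniz_div, D.leibniz, D.leibniz_pow, hDm, D2, Dq, smul_eq_mul,
      nsmul_eq_mul, Nat.cast_ofNat, mul_zero, add_zero]
    field_simp
    ring
  · field_simp
    ring

/-- PRINT DATUM (both texts): with `tr X = 2q̄Δ/|q|²` as printed at `[v1]` l.35500,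
l.35503–35504 (`[J]` p0869 L55–59, L83–94) the displayed two-term line equals
`6mΔ(|q|² − 1)/(q⁴|q|²)`, not `0`; compare `D54_nab4`.
[cite: GiorgiKlainermanSzeftel2024, p0869 L55–99; GiorgiKlainermanSzeftel2022, l.35500–35505] -/
theorem D54_nab4_printed_gap [CharZero K] (i r a m c : K) (hi : i ^ 2 = -1) (hN : nsq r a c ≠ 0) :
    -(6 * m / qq i r a c ^ 4) * (Del r a m / nsq r a c)
        + 3 / 2 * (2 * qb i r a c * Del r a m / nsq r a c) * (2 * m / qq i r a c ^ 3)
      = 6 * m * Del r a m * (nsq r a c - 1) / (qq i r a c ^ 4 * nsq r a c) := by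
  have hq := qq_ne_zero i r a c hi hN
  have hqb := qb_ne_zero i r a c hi hN
  rw [nsq_eq_qq_mul_qb i r a c hi]
  field_simp
  ring

/-! ## §5 Proposition D.5.5 (`[v1]` `prop:preliminaries-qfb-bianchi-lin`): substitution bookkeeping -/

section Bianchi

variable {M₁ : Type*} [AddCommGroup M₁] [Module K M₁]

/-- (D.5.7a): "In view of Lemma D.5.4, `ᶜ𝒟P = −3PH̲ + ᶜ𝒟P̌ + r⁻³Γ_g`, the equation
`ᶜ∇₄B̲ + tr X B̲ = −ᶜ𝒟P + B̄·X̲̂ − 3PH̲ − ½A̲·Ξ̄` becomes (with `Ξ = 0`)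
`ᶜ∇₄B̲ + tr X B̲ = −ᶜ𝒟P̌ + B̄·X̲̂ + r⁻³Γ_g`" — the `∓3PH̲` cancel; `g` names the `r⁻³Γ_g` of
(D.5.6a) (it reappears with sign `−`, i.e. inside the schematic class).
[cite: GiorgiKlainermanSzeftel2024, Proposition D.5.5 p0869 L100–122, p0870 L5–9; GiorgiKlainermanSzeftel2022, l.35510–35530, l.5267] -/
theorem D55_nab4_Bb (y p : K) (n4Bb Bb cDP cDPc BXh Hb AXi g : M₁)
    (hB : n4Bb + y • Bb = -cDP + BXh - (3 * p) • Hb - (1 / 2 : K) • AXi) (hXi : AXi = 0)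
    (hDP : cDP = -((3 * p) • Hb) + cDPc + g) :
    n4Bb + y • Bb = -cDPc + BXh - g := by
  rw [hB, hDP, hXi, smul_zero, sub_zero]
  abel

/-- (D.5.7b) (scalars): "Using `ᶜ∇₄P + (3/2) tr X P = ∇₄P̌ + (3/2) tr X P̌ + r⁻³Γ_g`, the equation
`ᶜ∇₄P − ½ ᶜ𝒟·B̄ = −(3/2) tr X P + H̲·B̄ − Ξ̄·B̲ − ¼ X̲̂·Ā` becomes (with `Ξ = 0`)
`∇₄P̌ + (3/2) tr X P̌ = ½ ᶜ𝒟·B̄ + H̲·B̄ − ¼ X̲̂·Ā + r⁻³Γ_g`" (coefficient `¼` in both texts).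
[cite: GiorgiKlainermanSzeftel2024, p0869 L104–111, p0870 L11–38; GiorgiKlainermanSzeftel2022, l.35515, l.35531–35540, l.5263] -/
theorem D55_nab4_Pc (y P Pc n4P n4Pc dcBc HbBc XibB XhA g : K)
    (hB : n4P - 1 / 2 * dcBc = -(3 / 2) * y * P + HbBc - XibB - 1 / 4 * XhA) (hXi : XibB = 0)
    (hL : n4P + 3 / 2 * y * P = n4Pc + 3 / 2 * y * Pc + g) :
    n4Pc + 3 / 2 * y * Pc = 1 / 2 * dcBc + HbBc - 1 / 4 * XhA - g := by
  linear_combination hB - hL - hXi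

end Bianchi

/-! ## §6 §D.5.2 "Proof of Proposition 5.3.1": Steps 1–4 and `err_TE` as module bookkeeping

Cast (opaque unless stated): scalars `x = tr X̲`, `xb = conj(tr X̲)`, `y = tr X`, `p = P`,
`n3P = ᶜ∇₃P`, `dcB = conj(ᶜ𝒟)·B̲`, `HcB = H̄·B̲`, `sAB` = the quadratic tail of the `ᶜ∇₃P`
identity (`Ξ̲·B̄ − ¼ conj(X̂)·A̲` at `[v1]` l.5266, quoted as `Ξ̲·B̄ − ¼ X̲̂·Ā` at l.35655; the
text's `(A, B)·Γ_b`); 1-forms `Bb = B̲`, `H`, `Hb = H̲`, `Xib = Ξ̲`, `W = conj(ᶜ𝒟)·A̲ + H̄·A̲`,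
`B3 = B̲₃`, `n3Bb = ᶜ∇₃B̲`, `n4Bb = ᶜ∇₄B̲`, `cDP = ᶜ𝒟P`, `gP` (the `r⁻²𝔡^{≤1}Γ_g` of `ᶜ𝒟P`),
`cDxb = ᶜ𝒟 conj(tr X̲)`, `g52` (the `r⁻¹Γ_g` of (D.5.2a)), `BXh = B̄·X̲̂`, `n3Hb = ᶜ∇₃H̲`,
`gH` (the `r⁻²Γ_b` of the `ᶜ∇₃H̲` equation); 2-tensors `hot u v = u ⊗̂ v` (bilinear),
`DhBb = ᶜ𝒟⊗̂B̲`, `Dhn3Bb = ᶜ𝒟⊗̂ᶜ∇₃B̲`, `DhB3 = ᶜ𝒟⊗̂B̲₃`, `DhW`, `DhXib = ᶜ𝒟⊗̂Ξ̲`,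
`n3DhBb = ᶜ∇₃ᶜ𝒟⊗̂B̲`, `comm = [ᶜ∇₃, ᶜ𝒟⊗̂]B̲`, `E1 = X̲̂·conj(ᶜ𝒟)B̲`, `E2 = (X̲̂·conj Ȟ)B̲`,
`G1` (the `r⁻²𝔡^{≤1}(Γ_g·Γ_b)` of the commutator), `n3HbBb = ᶜ∇₃(H̲⊗̂B̲)`, `Xbh = X̲̂`,
`n3Xbh = ᶜ∇₃X̲̂`, `n3PXbh = ᶜ∇₃(PX̲̂)`, `Ab = A̲`, `A4 = A̲₄`, `n3A4 = ᶜ∇₃A̲₄`. -/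

section Steps

variable {M₁ M₂ : Type*} [AddCommGroup M₁] [Module K M₁] [AddCommGroup M₂] [Module K M₂]
variable (hot : M₁ →ₗ[K] M₁ →ₗ[K] M₂)
variable (x xb y p n3P dcB HcB sAB : K)
variable (Bb H Hb Xib W B3 n3Bb n4Bb cDP gP cDxb g52 BXh n3Hb gH : M₁)
variable (DhBb Dhn3Bb DhB3 DhW DhXib n3DhBb comm E1 E2 G1 err1 n3HbBb Xbh n3Xbh n3PXbh Ab A4 n3A4
  I J Kt : M₂)

/-- Step 0: "To the Bianchi identity `A̲₄ = −½ ᶜ𝒟⊗̂B̲ − 2H̲⊗̂B̲ − 3PX̲̂` we apply the operator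
`ᶜ∇₃ + (2 conj(tr X̲) + ½ tr X̲)` and deduce `−ᶜ∇₃A̲₄ − (2x̄ + ½x)A̲₄ = I + J + K`" with
`I = ½ ᶜ∇₃ᶜ𝒟⊗̂B̲ + ½(2x̄ + ½x) ᶜ𝒟⊗̂B̲`, `J = 2ᶜ∇₃(H̲⊗̂B̲) + 2(2x̄ + ½x)H̲⊗̂B̲`,
`K = 3ᶜ∇₃(PX̲̂) + 3(2x̄ + ½x)PX̲̂`; `hn3` is the linearity of `ᶜ∇₃` on the identity.
[cite: GiorgiKlainermanSzeftel2024, p0870 L44–81 ("see Section 2.4.4"); GiorgiKlainermanSzeftel2022, l.35551–35561, l.5269] -/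
theorem step0_IJK [CharZero K]
    (hA4 : A4 = -((1 / 2 : K) • DhBb) - (2 : K) • hot Hb Bb - (3 * p) • Xbh)
    (hn3 : n3A4 = -((1 / 2 : K) • n3DhBb) - (2 : K) • n3HbBb - (3 : K) • n3PXbh)
    (hI : I = (1 / 2 : K) • n3DhBb + ((1 / 2 : K) * (2 * xb + 1 / 2 * x)) • DhBb)
    (hJ : J = (2 : K) • n3HbBb + (2 * (2 * xb + 1 / 2 * x)) • hot Hb Bb)
    (hK : Kt = (3 : K) • n3PXbh + (3 * (2 * xb + 1 / 2 * x) * p) • Xbh) :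
    -n3A4 - (2 * xb + 1 / 2 * x) • A4 = I + J + Kt := by
  subst hA4 hn3 hI hJ hK
  module

/-- Step 1, "`Ξ̲⊗̂ᶜ∇₄B̲ = Ξ̲⊗̂(−ᶜ𝒟P − tr X B̲ + B̄·X̲̂ − 3PH̲) = −tr X Ξ̲⊗̂B̲ + r⁻²𝔡^{≤1}(Γ_g·Γ_b)
+ (Γ_b·Γ_b)·B`", using `ᶜ𝒟P = −3PH̲ + gP` (the `±3PH̲` cancel); the schematic terms are
`−Ξ̲⊗̂gP` and `Ξ̲⊗̂(B̄·X̲̂)`.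
[cite: GiorgiKlainermanSzeftel2024, p0871 L23–33; GiorgiKlainermanSzeftel2022, l.35577–35581, l.5267] -/
theorem step1_Xi_nab4B
    (hn4 : n4Bb = -cDP - y • Bb + BXh - (3 * p) • Hb) (hDP : cDP = -((3 * p) • Hb) + gP) :
    hot Xib n4Bb = -(y • hot Xib Bb) + (hot Xib BXh - hot Xib gP) := by
  subst hn4 hDP
  simp only [map_add, map_sub, map_neg, map_smul]
  module

/-- Step 1, "This gives `ᶜ∇₃ᶜ𝒟⊗̂B̲ = ᶜ𝒟⊗̂ᶜ∇₃B̲ − ½ tr X̲ ᶜ𝒟⊗̂B̲ + H⊗̂ᶜ∇₃B̲ + err₁ + r⁻²𝔡^{≤1}(Γ_g·Γ_b)`,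
where `err₁ = −2B̲⊗̂B̲ − 2 tr X Ξ̲⊗̂B̲ − ½ X̲̂·conj(ᶜ𝒟)B̲ + (X̲̂·conj Ȟ)B̲ + (Γ_b·Γ_b)·B`",
from the commutation formula in its "can be written as" form (`hcomm`; the term
`−tr X Ξ̲⊗̂B̲` of the commutator and the one produced by `Ξ̲⊗̂ᶜ∇₄B̲` add up to the `−2 tr X Ξ̲⊗̂B̲`
of `err₁`), with the schematic remainder `G1 − Ξ̲⊗̂gP` kept explicit and
`(Γ_b·Γ_b)·B := Ξ̲⊗̂(B̄·X̲̂)`.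
[cite: GiorgiKlainermanSzeftel2024, p0870 L82–107 ("commutation formula (4.2.12)"), p0871 L5–59; GiorgiKlainermanSzeftel2022, l.35564–35590] -/
theorem step1_T0 [CharZero K]
    (hcomm : comm = -(((1 / 2 : K) * x) • DhBb) + hot H n3Bb + hot Xib n4Bb - (2 : K) • hot Bb Bb
      - y • hot Xib Bb - (1 / 2 : K) • E1 + G1 + E2)
    (hdef : n3DhBb = Dhn3Bb + comm)
    (hn4 : n4Bb = -cDP - y • Bb + BXh - (3 * p) • Hb) (hDP : cDP = -((3 * p) • Hb) + gP)
    (herr1 : err1 = -((2 : K) • hot Bb Bb) - (2 * y) • hot Xib Bb - (1 / 2 : K) • E1 + E2 + hot Xib BXh) :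
    n3DhBb = Dhn3Bb - ((1 / 2 : K) * x) • DhBb + hot H n3Bb + err1 + (G1 - hot Xib gP) := by
  have hX := step1_Xi_nab4B hot y p Bb Hb Xib n4Bb cDP gP BXh hn4 hDP
  subst herr1 hdef
  rw [hcomm, hX]
  module

/-- Step 1, "Using the definition `B̲₃ = ᶜ∇₃B̲ + 2 conj(tr X̲) B̲`, we have … This implies
`ᶜ∇₃ᶜ𝒟⊗̂B̲ = ᶜ𝒟⊗̂B̲₃ + H⊗̂B̲₃ − (2x̄ + ½x) ᶜ𝒟⊗̂B̲ − (2ᶜ𝒟x̄ + 2x̄H)⊗̂B̲ + err₁ + …`";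
`hDh` is the Leibniz expansion `ᶜ𝒟⊗̂(B̲₃ − 2x̄B̲) = ᶜ𝒟⊗̂B̲₃ − 2x̄ ᶜ𝒟⊗̂B̲ − 2ᶜ𝒟x̄⊗̂B̲`.
[cite: GiorgiKlainermanSzeftel2024, p0871 L60–110; GiorgiKlainermanSzeftel2022, l.35591–35598] -/
theorem step1_T1 [CharZero K]
    (hT0 : n3DhBb = Dhn3Bb - ((1 / 2 : K) * x) • DhBb + hot H n3Bb + err1 + (G1 - hot Xib gP))
    (hB3def : n3Bb = B3 - (2 * xb) • Bb)
    (hDh : Dhn3Bb = DhB3 - (2 * xb) • DhBb - (2 : K) • hot cDxb Bb) :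
    n3DhBb = DhB3 + hot H B3 - (2 * xb + 1 / 2 * x) • DhBb - hot ((2 : K) • cDxb + (2 * xb) • H) Bb
      + err1 + (G1 - hot Xib gP) := by
  subst hT0 hB3def hDh
  simp only [map_add, map_sub, map_smul, LinearMap.add_apply, LinearMap.smul_apply]
  module

/-- Step 1, the display defining `I` (`[v1]` l.35601–35602, `[J]` p0871 L101–111): halving the
previous display gives
`I = ½ ᶜ𝒟⊗̂B̲₃ + ½ H⊗̂B̲₃ − (ᶜ𝒟x̄ + x̄H)⊗̂B̲ + ½err₁ + ½(…)`.  PRINT DATUM 4 of the header: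
both texts print `+ err₁` here (and carry the un-halved `err₁` to `err_TE`); the kernel's
coefficient is `½`.
[cite: GiorgiKlainermanSzeftel2024, p0871 L89–111; GiorgiKlainermanSzeftel2022, l.35599–35603] -/
theorem step1_I [CharZero K]
    (hT1 : n3DhBb = DhB3 + hot H B3 - (2 * xb + 1 / 2 * x) • DhBb - hot ((2 : K) • cDxb + (2 * xb) • H) Bb
      + err1 + (G1 - hot Xib gP))
    (hI : I = (1 / 2 : K) • n3DhBb + ((1 / 2 : K) * (2 * xb + 1 / 2 * x)) • DhBb) :
    I = (1 / 2 : K) • DhB3 + (1 / 2 : K) • hot H B3 - hot (cDxb + xb • H) Bb + (1 / 2 : K) • err1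
      + (1 / 2 : K) • (G1 - hot Xib gP) := by
  subst hI hT1
  simp only [map_add, map_smul, LinearMap.add_apply, LinearMap.smul_apply]
  module

/-- Step 1, end: "Making use of `B̲₃ = −½W − 3PΞ̲` we deduce `I = −¼ ᶜ𝒟⊗̂W − ¼ H⊗̂W
− (3/2)P ᶜ𝒟⊗̂Ξ̲ − (3/2)(ᶜ𝒟P)⊗̂Ξ̲ − (3/2)PH⊗̂Ξ̲ − (ᶜ𝒟x̄ + x̄H)⊗̂B̲ + …`.  Using again (D.5.6),
`𝒟P = −3PH̲ + r⁻²Γ_g`, we obtain `I = … − (3/2)P ᶜ𝒟⊗̂Ξ̲ + ((9/2)PH̲ − (3/2)PH)⊗̂Ξ̲ − …`";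
`hDhB3` is the Leibniz expansion `ᶜ𝒟⊗̂(−½W − 3PΞ̲) = −½ ᶜ𝒟⊗̂W − 3(P ᶜ𝒟⊗̂Ξ̲ + ᶜ𝒟P⊗̂Ξ̲)`.
The `err₁` coefficient is the kernel's `½` (print datum 4); schematic remainder explicit.
[cite: GiorgiKlainermanSzeftel2024, p0871 L113–123, p0872 L5–53; GiorgiKlainermanSzeftel2022, l.35604–35619] -/
theorem step1_I_final [CharZero K]
    (hIline : I = (1 / 2 : K) • DhB3 + (1 / 2 : K) • hot H B3 - hot (cDxb + xb • H) Bb + (1 / 2 : K) • err1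
      + (1 / 2 : K) • (G1 - hot Xib gP))
    (hB3 : B3 = -((1 / 2 : K) • W) - (3 * p) • Xib)
    (hDhB3 : DhB3 = -((1 / 2 : K) • DhW) - (3 : K) • (p • DhXib + hot cDP Xib))
    (hDP : cDP = -((3 * p) • Hb) + gP) :
    I = -((1 / 4 : K) • DhW) - (1 / 4 : K) • hot H W - ((3 / 2 : K) * p) • DhXib
      + ((9 / 2 : K) * p) • hot Hb Xib - ((3 / 2 : K) * p) • hot H Xib - hot (cDxb + xb • H) Bb
      + (1 / 2 : K) • err1 + ((1 / 2 : K) • (G1 - hot Xib gP) - (3 / 2 : K) • hot gP Xib) := by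
  subst hIline hB3 hDhB3 hDP
  simp only [map_add, map_sub, map_neg, map_smul, LinearMap.add_apply, 
    LinearMap.neg_apply, LinearMap.smul_apply]
  module

/-- Step 2: "`J = 2ᶜ∇₃(H̲⊗̂B̲) + 2(2x̄ + ½x)H̲⊗̂B̲ = 2ᶜ∇₃H̲⊗̂B̲ + 2H̲⊗̂ᶜ∇₃B̲ + 4x̄ H̲⊗̂B̲ + x H̲⊗̂B̲
= 2ᶜ∇₃H̲⊗̂B̲ + 2H̲⊗̂(B̲₃ − 2x̄B̲) + … = 2ᶜ∇₃H̲⊗̂B̲ + 2H̲⊗̂B̲₃ + x H̲⊗̂B̲`"; `hLeib` is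
`ᶜ∇₃(H̲⊗̂B̲) = ᶜ∇₃H̲⊗̂B̲ + H̲⊗̂ᶜ∇₃B̲`.
[cite: GiorgiKlainermanSzeftel2024, p0872 L55–80; GiorgiKlainermanSzeftel2022, l.35621–35628] -/
theorem step2_J_expand [CharZero K]
    (hJ : J = (2 : K) • n3HbBb + (2 * (2 * xb + 1 / 2 * x)) • hot Hb Bb)
    (hLeib : n3HbBb = hot n3Hb Bb + hot Hb n3Bb) (hB3def : n3Bb = B3 - (2 * xb) • Bb) :
    J = (2 : K) • hot n3Hb Bb + (2 : K) • hot Hb B3 + x • hot Hb Bb := by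
  subst hJ hLeib hB3def
  simp only [map_sub, map_smul]
  module

/-- Step 2, end: "Making use of `ᶜ∇₃H̲ = −½x̄(H̲ − H) + B̲ + r⁻²Γ_b` and `B̲₃ = −½W − 3PΞ̲` we deduce
`J = −H̲⊗̂W + (−x̄(H̲ − H) + xH̲)⊗̂B̲ − 6PH̲⊗̂Ξ̲ + 2B̲⊗̂B̲ + r⁻³(Γ_b·Γ_b)`" with
`r⁻³(Γ_b·Γ_b) := 2gH⊗̂B̲`.
[cite: GiorgiKlainermanSzeftel2024, p0872 L81–124; GiorgiKlainermanSzeftel2022, l.35629–35644, l.5246] -/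
theorem step2_J_final [CharZero K]
    (hJline : J = (2 : K) • hot n3Hb Bb + (2 : K) • hot Hb B3 + x • hot Hb Bb)
    (hn3Hb : n3Hb = -((1 / 2 : K) • (xb • (Hb - H))) + Bb + gH)
    (hB3 : B3 = -((1 / 2 : K) • W) - (3 * p) • Xib) :
    J = -hot Hb W + hot (-(xb • (Hb - H)) + x • Hb) Bb - (6 * p) • hot Hb Xib + (2 : K) • hot Bb Bb
      + (2 : K) • hot gH Bb := by
  subst hJline hn3Hb hB3
  simp only [map_add, map_sub, map_neg, map_smul, LinearMap.add_apply, LinearMap.sub_apply,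
    LinearMap.neg_apply, LinearMap.smul_apply]
  module

/-- Step 3: "`K = 3ᶜ∇₃(PX̲̂) + 3(2x̄ + ½x)PX̲̂ = 3ᶜ∇₃P X̲̂ + 3Pᶜ∇₃X̲̂ + 6x̄PX̲̂ + (3/2)xPX̲̂`.  Making use
of `ᶜ∇₃P = −(3/2)x̄P − ½ conj(ᶜ𝒟)·B̲ − H̄·B̲ + (A, B)·Γ_b` and
`ᶜ∇₃X̲̂ = −½(x + x̄)X̲̂ + ½ ᶜ𝒟⊗̂Ξ̲ + ½ Ξ̲⊗̂(H + H̲) − A̲` we obtain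
`K = (3/2)P ᶜ𝒟⊗̂Ξ̲ + (3/2)P Ξ̲⊗̂(H + H̲) − 3PA̲ + (−(3/2)conj(ᶜ𝒟)·B̲ − 3H̄·B̲)X̲̂ + (Γ_b·Γ_b)·(A, B)`"
— the `x̄PX̲̂` coefficients `−9/2 − 3/2 + 6` and the `xPX̲̂` coefficients `−3/2 + 3/2` cancel;
`(Γ_b·Γ_b)·(A, B) := 3 sAB X̲̂`; `hLeib` is `ᶜ∇₃(PX̲̂) = ᶜ∇₃P X̲̂ + P ᶜ∇₃X̲̂`.
[cite: GiorgiKlainermanSzeftel2024, p0873 L5–76; GiorgiKlainermanSzeftel2022, l.35647–35665, l.5266] -/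
theorem step3_K_final [CharZero K]
    (hK : Kt = (3 : K) • n3PXbh + (3 * (2 * xb + 1 / 2 * x) * p) • Xbh)
    (hLeib : n3PXbh = n3P • Xbh + p • n3Xbh)
    (hn3P : n3P = -(3 / 2) * xb * p - 1 / 2 * dcB - HcB + sAB)
    (hn3Xbh : n3Xbh = -(((1 / 2 : K) * (x + xb)) • Xbh) + (1 / 2 : K) • DhXib
      + (1 / 2 : K) • hot Xib (H + Hb) - Ab) :
    Kt = ((3 / 2 : K) * p) • DhXib + ((3 / 2 : K) * p) • hot Xib (H + Hb) - (3 * p) • Ab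
      + (-(3 / 2) * dcB - 3 * HcB) • Xbh + (3 * sAB) • Xbh := by
  subst hK hLeib hn3P hn3Xbh
  module

/-- Step 4: "By summing the above three terms we obtain the cancellation of the terms in `Ξ̲`, and
we deduce `I + J + K = −¼ ᶜ𝒟⊗̂W − ¼(H + 4H̲)⊗̂W − 3PA̲ − (ᶜ𝒟x̄ + (x̄ − x)H̲)⊗̂B̲ + err₁ + …
+ 2B̲⊗̂B̲ + r⁻³(Γ_b·Γ_b) + (−(3/2)conj(ᶜ𝒟)·B̲ − 3H̄·B̲)X̲̂ + (Γ_b·Γ_b)·(A, B)`" — from the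
final forms of `I`, `J`, `K` (`step1_I_final`, `step2_J_final`, `step3_K_final`) and the
symmetry of `⊗̂` on 1-forms (`Ξ̲⊗̂H = H⊗̂Ξ̲`): the `Ξ̲`-coefficients `−3/2 + 3/2` (`ᶜ𝒟⊗̂Ξ̲`),
`9/2 − 6 + 3/2` (`PH̲⊗̂Ξ̲`), `−3/2 + 3/2` (`PH⊗̂Ξ̲`) vanish.  The `err₁` coefficient is the
kernel's `½` (print datum 4); all schematic terms are carried explicitly.
[cite: GiorgiKlainermanSzeftel2024, p0873 L77–102; GiorgiKlainermanSzeftel2022, l.35668–35676] -/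
theorem step4_sum [CharZero K] (hsym : ∀ u v : M₁, hot u v = hot v u)
    (hI : I = -((1 / 4 : K) • DhW) - (1 / 4 : K) • hot H W - ((3 / 2 : K) * p) • DhXib
      + ((9 / 2 : K) * p) • hot Hb Xib - ((3 / 2 : K) * p) • hot H Xib - hot (cDxb + xb • H) Bb
      + (1 / 2 : K) • err1 + ((1 / 2 : K) • (G1 - hot Xib gP) - (3 / 2 : K) • hot gP Xib))
    (hJ : J = -hot Hb W + hot (-(xb • (Hb - H)) + x • Hb) Bb - (6 * p) • hot Hb Xib + (2 : K) • hot Bb Bb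
      + (2 : K) • hot gH Bb)
    (hK : Kt = ((3 / 2 : K) * p) • DhXib + ((3 / 2 : K) * p) • hot Xib (H + Hb) - (3 * p) • Ab
      + (-(3 / 2) * dcB - 3 * HcB) • Xbh + (3 * sAB) • Xbh) :
    I + J + Kt = -((1 / 4 : K) • DhW) - (1 / 4 : K) • hot (H + (4 : K) • Hb) W - (3 * p) • Ab
      - hot (cDxb + (xb - x) • Hb) Bb
      + ((1 / 2 : K) • err1 + (2 : K) • hot Bb Bb + (-(3 / 2) * dcB - 3 * HcB) • Xbh
        + ((1 / 2 : K) • (G1 - hot Xib gP) - (3 / 2 : K) • hot gP Xib + (2 : K) • hot gH Bb + (3 * sAB) • Xbh)) := by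
  subst hI hJ hK
  rw [hsym Xib (H + Hb)]
  simp only [map_add, map_sub, map_neg, map_smul, LinearMap.add_apply, LinearMap.sub_apply,
    LinearMap.neg_apply, LinearMap.smul_apply]
  module

/-- Step 4, the `B̲`-coefficient: "Using (D.5.2), i.e. `ᶜ𝒟 conj(tr X̲) = 2i Im(tr X̲) H̲ + r⁻¹Γ_g`"
(`2i Im(tr X̲) = x − x̄`; `g52` the `r⁻¹Γ_g`), `−(ᶜ𝒟x̄ + (x̄ − x)H̲)⊗̂B̲ = −g52⊗̂B̲`
(`= r⁻²𝔡^{≤1}(Γ_g·Γ_b)`).  The Kerr part of (D.5.2a) is `D51_conj_trXb`.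
[cite: GiorgiKlainermanSzeftel2024, p0873 L103–107, p0874 L1–13; GiorgiKlainermanSzeftel2022, l.35673, l.35677–35687] -/
theorem step4_B_coefficient (h52 : cDxb = (x - xb) • Hb + g52) :
    -hot (cDxb + (xb - x) • Hb) Bb = -hot g52 Bb := by
  subst h52
  simp only [map_add, map_smul, LinearMap.add_apply, LinearMap.smul_apply]
  module

/-- `err_TE` as the kernel collects it from Steps 1–4 (with `½err₁`, print datum 4): expanding
`err₁`, the literal error term is
`B̲⊗̂B̲ − tr X Ξ̲⊗̂B̲ − ¼ X̲̂·conj(ᶜ𝒟)B̲ + ½(X̲̂·conj Ȟ)B̲ + ½(Γ_b·Γ_b)·B − (3/2)(conj(ᶜ𝒟)·B̲)X̲̂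
− 3(H̄·B̲)X̲̂ + [schematic]` — the coefficient of `B̲⊗̂B̲` is `1`.
[cite: GiorgiKlainermanSzeftel2024, p0874 L14–40; GiorgiKlainermanSzeftel2022, l.35589, l.35696–35708] -/
theorem errTE_derived [CharZero K] (sch : M₂)
    (herr1 : err1 = -((2 : K) • hot Bb Bb) - (2 * y) • hot Xib Bb - (1 / 2 : K) • E1 + E2 + hot Xib BXh) :
    (1 / 2 : K) • err1 + (2 : K) • hot Bb Bb + (-(3 / 2) * dcB - 3 * HcB) • Xbh + sch
      = (1 : K) • hot Bb Bb - y • hot Xib Bb - (1 / 4 : K) • E1 + (1 / 2 : K) • E2 + (1 / 2 : K) • hot Xib BXh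
        - ((3 / 2 : K) * dcB) • Xbh - (3 * HcB) • Xbh + sch := by
  subst herr1
  module

/-- The printed chain for `err_TE` (`[v1]` l.35698–35707, `[J]` p0874), which carries the
UN-halved `err₁`: "`err_TE = err₁ + … + 2B̲⊗̂B̲ + … = −2B̲⊗̂B̲ − 2 tr X Ξ̲⊗̂B̲ − ½X̲̂·conj(ᶜ𝒟)B̲
+ (X̲̂·conj Ȟ)B̲ + (Γ_b·Γ_b)·B + … + 2B̲⊗̂B̲ + …, which gives err_TE = −2 tr X Ξ̲⊗̂B̲ − ½X̲̂·conj(ᶜ𝒟)B̲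
− (3/2)(conj(ᶜ𝒟)·B̲)X̲̂ + (X̲̂·conj Ȟ)B̲ + …`" — internally consistent: with coefficient `1` on
`err₁` the `B̲⊗̂B̲` terms cancel.  Compare `errTE_derived`.
[cite: GiorgiKlainermanSzeftel2024, p0874 L14–40; GiorgiKlainermanSzeftel2022, l.35696–35708] -/
theorem errTE_printed_chain (sch : M₂)
    (herr1 : err1 = -((2 : K) • hot Bb Bb) - (2 * y) • hot Xib Bb - (1 / 2 : K) • E1 + E2 + hot Xib BXh) :
    err1 + (2 : K) • hot Bb Bb + (-(3 / 2) * dcB - 3 * HcB) • Xbh + sch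
      = -((2 * y) • hot Xib Bb) - (1 / 2 : K) • E1 - ((3 / 2 : K) * dcB) • Xbh + E2 + hot Xib BXh
        - (3 * HcB) • Xbh + sch := by
  subst herr1
  module

/-- The final form (5.3.1) / `[v1]` (eq:Teuk-Ab-Ab4) is the negative of the App. D display:
`−¼ ᶜ𝒟⊗̂W − ¼(H + 4H̲)⊗̂W = −¼(ᶜ𝒟⊗̂W + (H + 4H̲)⊗̂W)` ("`−¼(ᶜ𝒟 + H + 4H̲)⊗̂W`"), so that
`(ᶜ∇₃ + 2x̄ + ½x)A̲₄ = ¼(ᶜ𝒟 + H + 4H̲)⊗̂W + 3PA̲ − Err_TE[A̲]` (the Proposition's `err_TE` is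
schematic, i.e. up to sign).
[cite: GiorgiKlainermanSzeftel2024, (5.3.1) p0198 L23–40, p0874 L1–13; GiorgiKlainermanSzeftel2022, l.9045–9054, l.35689–35695] -/
theorem final_form_sign (LHS ErrTE : M₂)
    (h : -LHS = -((1 / 4 : K) • DhW) - (1 / 4 : K) • hot (H + (4 : K) • Hb) W - (3 * p) • Ab + ErrTE) :
    LHS = (1 / 4 : K) • (DhW + hot (H + (4 : K) • Hb) W) + (3 * p) • Ab - ErrTE := by
  rw [show LHS = -(-LHS) from (neg_neg LHS).symm, h]
  module

end Steps

end Literature.Geometry.Lorentzian.GiorgiKlainermanSzeftel2022.TeukolskyAbarLedger
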